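import Literature.NumberTheory.Automorphic.BaseChangeArchimedean
import Literature.NumberTheory.GaloisRepresentations.FrobeniusDensityTheorem
import Literature.NumberTheory.Automorphic.ReciprocityGLnPatchingAssembly
import Literature.NumberTheory.Automorphic.ReciprocityGLnPatchingFamily
import Literature.NumberTheory.Automorphic.ReciprocityGLnLeavesProofs
import Literature.NumberTheory.Automorphic.HarrisLanTaylorThorneCor627Proofs
import Literature.NumberTheory.GaloisRepresentations.TwistedSumDecompositionProofs
import Mathlib.NumberTheory.RamificationInertia.Valuation
import Mathlib.NumberTheory.RamificationInertia.Unramified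
import HarnessLib

/-!
# Harris–Lan–Taylor–Thorne, Thm. A (existence, `n ≥ 2`) from its three automorphic leaves:
# Cor. 6.27, strong quadratic base change, and the archimedean clause

Topic `Literature/NumberTheory/Automorphic`; theorems only (no definition, no named fact, no
instance).  This file closes the formalisation of the **printed proof of the existence half of
Harris–Lan–Taylor–Thorne's Theorem A** (`HarrisLanTaylorThorne2016.theoremA_existence`,
`ReciprocityGLnProofs`) = Cor. 7.14 (p. 232: "This can be deduced from Theorem 7.13 by using lemma 1
of [54]. (This is the same argument used in the proof of theorem VII.1.9 of [29].)") for `n ≥ 2`,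
**modulo named automorphic leaves only**:

* `HarrisLanTaylorThorne2016.corollary627_splitOrUnramified` — HLTT Cor. 6.27 (rigid cohomology of
  the ordinary locus of the `U(n,n)`-Shimura variety; named fact, `HarrisLanTaylorThorneCor627`),
  through Thm. 7.13 (`theorem713_of_leaves`, `ReciprocityGLnLeavesProofs`, whose other two leaves
  are now theorems: `prop712Hausdorff_holds`, `chebotarev_artinRep_holds`);
* the **strong quadratic base change** of Arthur–Clozel (Ch. 3, Thm. 4.2 (a) with Thm. 5.1 and
  (1.1)): for `E/F` Galois of prime degree ramified at a finite place where the cuspidal `π` is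
  unramified (so that `π ≇ π ⊗ η_{E/F}`, Chenevier–Harris 2013, proof of Prop. 3.1.1), a *cuspidal*
  `Π` on `GL_n(𝔸_E)` with the Satake relation `t_{Π,w} = t_{π,v}^{f(w|v)}` at **every** place `w`
  over a `v` unramified in `E` (the unramified content of a *strong* lift, Def. 1.2; the predicate
  `IsUnramifiedBaseChangeLift` of the sibling `BaseChangeUnramifiedLift`, proposed alongside this
  file, names this relation).  The
  tree has this theorem only almost everywhere (`exists_baseChange_cyclic`,
  `baseChange_cyclic_cuspidal`), and a discharge seat may not vendor a new named fact (D-0026), so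
  it enters here as the explicit hypothesis `hBC`, with the relation spelled out (so that this
  proofs file is self-contained) — a future cite item names the theorem and feeds it in;
* `ArthurClozel1989_strongLifting_archimedean` (`BaseChangeArchimedean`; the archimedean clause of
  Thm. 5.1: the base change of a regular algebraic `π` is regular algebraic).

Everything else in the printed proof is proved in the tree: Sorensen's patching lemma
(`PatchingLemma`, `SorensenPatching`, `SorensenPatchingHypotheses`), the `∅`-general family
`K(√-D)`, `D ∈ GoodPrime K (8ℓ) B` (`SGeneralQuadraticFamily`: Dirichlet, Hensel, infinite Galois
theory), its members being CM with an imaginary quadratic subfield `ℚ(√-D)` in which `ℓ` splits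
(`ReciprocityGLnPatchingFamily`), the Galois half of Cor. 7.14 — hypotheses (a), (b) of the patching
lemma from almost-everywhere Frobenius data by Chebotarev, patching, descent at completely split
places (`ReciprocityGLnPatchingGalois`, `ReciprocityGLnPatchingAssembly`, `AbsGaloisOuterConj`,
`ReciprocityGLnGaloisConjProofs`, `ReciprocityGLnRestrictionProofs`, `ReciprocityGLnDescentProofs`,
`FramedRepEquivConj`, `RestrictFieldSemisimple`, `CliffordRestriction`) — and, here, the
automorphic bookkeeping of the members.

## Contents

* §1 `PatchingFamily.isUnramifiedIn_of_ncard_eq_finrank`, `inertiaDeg_eq_one_of_ncard_eq_finrank` —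
  a place with `[M:K]` primes above it in a Galois `M/K` is unramified with all residue degrees `1`.
* §2 **The members are ramified above `D`**: `intValuation_natCast_eq_of_isUnramifiedAt` — at a
  prime `v ∋ D` of `K` unramified over `ℤ`, `v(D) = 1`; `not_isUnramifiedIn_sqrtNegField` — then `v`
  ramifies in `K(√-D)` (`ω² = -D` has odd valuation; Mathlib `intValuation_liesOver`).  This is the
  cuspidality criterion of Chenevier–Harris's Prop. 3.1.1 for the family.
* §3 `PatchingFamily.exists_intermediateField_hasTwoPrimesOver` — the subfield `F₀ = ℚ(√-D) ⊆ K(√-D)`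
  is imaginary quadratic and **every** prime `q` with `8q ∣ D + 1` splits in it (refines
  `hasSplitImaginaryQuadraticSubfield_sqrtNegField`, which hid `F₀` behind an existential, so that
  the same `F₀` serves `ℓ` and the auxiliary `q` of the read-off step).
* §4 `HarrisLanTaylorThorne2016.exists_rep_member` — **the representation of a member**: for
  `D ∈ GoodPrime K (8ℓ) B` (`B ⊇` the primes below a place ramified over `ℤ` or a ramified place of
  `π`), the base change `π_D` of `π` to `K_D = K(√-D)` (via `hBC` at the ramified place above `D`) is
  cuspidal regular algebraic on the CM field `K_D ⊇ ℚ(√-D) ∋` split `ℓ`, and `r_{ℓ,ı}(π_D)` of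
  Thm. 7.13 is semisimple, compatible almost everywhere with the Frobenius datum of `π`
  (`CompatibleAE`, from Thm. 7.13 at the cofinitely many good places, `finite_setOf_not_exists_goodPrime`,
  the strong base-change relation and `arithFrobPolyOfSatake_pow`), and compatible with `π_v` at
  every place over every `v ∣ q` for the good rational primes `q` with `8q ∣ D + 1` (first
  alternative of Thm. 7.13: `q` splits in `ℚ(√-D)`; `v` splits completely in `K_D`, so `f = 1` and
  the strong relation reads `t_{π_D,w} = t_{π,v}`).
* §5 `HarrisLanTaylorThorne2016.theoremA_existence_of_baseChange` — **Thm. A, existence, `n ≥ 2`**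
  from `h627`, `hBC`, `harch`: `exists_isCompatible_of_members'` fed with §4 and
  `GoodPrime.exists_dvd_split` (a member with `8q ∣ D + 1` in which `v` splits completely).
  `theoremA_existence` itself (all `n`) additionally needs the case `n = 1` (Weil 1956: `ℓ`-adic
  characters of algebraic Hecke characters — "We may suppose that `n > 1`, as in the case `n = 1`
  the result is well known", HLTT p. 232; in progress in
  `GaloisRepresentations/AlgebraicHeckeCharacterGrossencharakterProofs`) and `n = 0`.
* §6 `theoremA_existence_rank_zero` (the degenerate `n = 0`, proved) and
  `theoremA_existence_of_leaves` — `theoremA_existence` for all `n` from the three leaves and its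
  own case `n = 1` (Weil's theorem, hypothesis `h₁`): the exact residue of a discharge.

## References

* M. Harris, K.-W. Lan, R. Taylor, J. Thorne, *On the rigid cohomology of certain Shimura
  varieties*, Res. Math. Sci. 3:37 (2016), Thm. A (p. 3), Cor. 6.27 (p. 225), Thm. 7.13 and
  Cor. 7.14 (p. 232). [HarrisLanTaylorThorneRMS2016]
* M. Harris, R. Taylor, *The geometry and cohomology of some simple Shimura varieties*, Ann. of
  Math. Stud. 151 (2001), proof of Thm. VII.1.9 (pp. 229–232). [HarrisTaylorAMS2001]
* J. Arthur, L. Clozel, *Simple algebras, base change, and the advanced theory of the trace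
  formula*, Ann. of Math. Stud. 120 (1989), Ch. 3, (1.1), Def. 1.2, Thm. 4.2 (a), Thm. 5.1.
  [ArthurClozelAMS120]
* G. Chenevier, M. Harris, *Construction of automorphic Galois representations, II*, Camb. J. Math.
  1 (2013), proof of Prop. 3.1.1 (p. 64). [ChenevierHarris2013]
* C. M. Sorensen, *A patching lemma*, in *Shimura Varieties*, LMS Lecture Note Ser. 457 (2020),
  Lemma 2 and the Example of §1. [Sorensen2020]
-/

noncomputable section

open scoped MatrixGroups Matrix Classical Polynomial NumberField IntermediateField
open NumberField IsDedekindDomain Field Polynomial Filter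
open Literature.NumberTheory.GaloisRepresentations
open Literature.NumberTheory.GaloisRepresentations.QuadraticFamily
open Literature.NumberTheory.Automorphic.PatchingFamily

namespace Literature.NumberTheory.Automorphic

/-! ### §1. Completely split places are unramified with residue degree one -/

namespace PatchingFamily

section Split

variable {K M : Type*} [Field K] [NumberField K] [Field M] [NumberField M] [Algebra K M]
  [IsGalois K M]

/-- In a Galois extension `M/K`, a place `v` with `[M : K]` places above it is **unramified** in `M`
(`e(v) = 1` from the fundamental identity, `ramificationIdxIn_eq_one_of_ncard_eq_finrank`, and
`e(w|v) = e(v)` for every `w ∣ v`, Mathlib `Ideal.ramificationIdxIn_eq_ramificationIdx`).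
[folklore] -/
theorem isUnramifiedIn_of_ncard_eq_finrank (v : HeightOneSpectrum (𝓞 K))
    (h : (v.asIdeal.primesOver (𝓞 M)).ncard = Module.finrank K M) :
    Algebra.IsUnramifiedIn (𝓞 M) v.asIdeal := by
  rw [Algebra.isUnramifiedIn_iff_forall_ramificationIdx_eq_one]
  intro P _ hP
  haveI := hP
  rw [← Ideal.ramificationIdxIn_eq_ramificationIdx v.asIdeal P (M ≃ₐ[K] M)]
  exact (ramificationIdxIn_eq_one_of_ncard_eq_finrank v h).1

/-- In a Galois extension `M/K`, every place above a place `v` with `[M : K]` places above it has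
**residue degree one** (`f(v) = 1`, `ramificationIdxIn_eq_one_of_ncard_eq_finrank`; Mathlib
`Ideal.inertiaDegIn_eq_inertiaDeg`). [folklore] -/
theorem inertiaDeg_eq_one_of_ncard_eq_finrank (v : HeightOneSpectrum (𝓞 K))
    (h : (v.asIdeal.primesOver (𝓞 M)).ncard = Module.finrank K M) (w : HeightOneSpectrum (𝓞 M))
    (hw : w.asIdeal.under (𝓞 K) = v.asIdeal) : w.asIdeal.inertiaDeg (𝓞 K) = 1 := by
  haveI : w.asIdeal.LiesOver v.asIdeal := ⟨hw.symm⟩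
  rw [← Ideal.inertiaDegIn_eq_inertiaDeg v.asIdeal w.asIdeal (M ≃ₐ[K] M)]
  exact (ramificationIdxIn_eq_one_of_ncard_eq_finrank v h).2

end Split

/-! ### §2. The members `K(√-D)` are ramified above `D` -/

section Ramified

variable {K : Type*} [Field K] [NumberField K]

/-- **`v(D) = 1` at a place `v ∋ D` unramified over `ℤ`**: for a rational prime `D` and a prime `v`
of `𝓞 K` containing `D` with `e(v|D) = 1` (Mathlib `Algebra.IsUnramifiedAt ℤ v`,
`Ideal.ramificationIdx_eq_one`), the `v`-adic valuation of `D` is `exp(-1)`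
(Mathlib `intValuation_liesOver` over the prime `(D)` of `ℤ`, `intValuation_singleton`).
[folklore] -/
theorem intValuation_natCast_eq_of_isUnramifiedAt {D : ℕ} (hD : D.Prime)
    (v : HeightOneSpectrum (𝓞 K)) (hv : ((D : ℕ) : 𝓞 K) ∈ v.asIdeal)
    (hunr : Algebra.IsUnramifiedAt ℤ v.asIdeal) :
    v.intValuation ((D : ℕ) : 𝓞 K) = WithZero.exp (-1 : ℤ) := by
  have hD0 : (D : ℤ) ≠ 0 := by exact_mod_cast hD.ne_zero
  have hDp : Prime (D : ℤ) := Nat.prime_iff_prime_int.mp hD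
  let v₀ : HeightOneSpectrum ℤ :=
    ⟨Ideal.span {(D : ℤ)}, (Ideal.span_singleton_prime hD0).mpr hDp, by
      rw [Ne, Ideal.span_singleton_eq_bot]; exact hD0⟩
  haveI : v.asIdeal.LiesOver v₀.asIdeal :=
    ((natCast_mem_asIdeal_iff_mem_primesOver K hD v).mp hv).2
  haveI := hunr
  have h := HeightOneSpectrum.intValuation_liesOver (A := ℤ) (B := 𝓞 K) v₀ v (D : ℤ)
  rw [Ideal.ramificationIdx'_eq_ramificationIdx v₀.asIdeal v.asIdeal v₀.ne_bot,
    Ideal.ramificationIdx_eq_one v.asIdeal ℤ, pow_one,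
    HeightOneSpectrum.intValuation_singleton (v := v₀) hD0 rfl, map_natCast] at h
  exact h.symm

/-- **The quadratic extension `K(√-D)/K` is ramified at every place `v` with `v(D) = 1`.**  If
`v` were unramified in `L = K(√-D)`, then for a prime `w ∣ v` of `L` one would have `e(w|v) = 1`
(Mathlib `Algebra.IsUnramifiedIn.ramificationIdx_eq_one`) and `w(D) = v(D)^{e(w|v)} = exp(-1)`
(`intValuation_liesOver`); but `D = -ω²` with `ω = √-D ∈ 𝓞 L`, so `w(D) = w(ω)²` is a square —
contradiction.  (Chenevier–Harris 2013, proof of Prop. 3.1.1: the members of the family are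
"ramified at at least one finite place … at which `Π` is unramified".) [folklore] -/
theorem not_isUnramifiedIn_sqrtNegField {D : ℕ} [Fact (¬ IsSquare (-(D : K)))]
    (v : HeightOneSpectrum (𝓞 K)) (hval : v.intValuation ((D : ℕ) : 𝓞 K) = WithZero.exp (-1 : ℤ)) :
    ¬ Algebra.IsUnramifiedIn (𝓞 (sqrtNegField K D)) v.asIdeal := by
  intro hunr
  -- `ω = √-D` is an algebraic integer
  have hω : (QuadraticAlgebra.omega : sqrtNegField K D) ^ 2 = -((D : ℕ) : sqrtNegField K D) := by
    rw [omega_sq, map_neg, map_natCast]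
  have hint : IsIntegral ℤ (QuadraticAlgebra.omega : sqrtNegField K D) := by
    refine ⟨X ^ 2 + C (D : ℤ), monic_X_pow_add_C _ two_ne_zero, ?_⟩
    simp [hω]
  set ω₀ : 𝓞 (sqrtNegField K D) := ⟨QuadraticAlgebra.omega, hint⟩ with hω₀def
  have hω₀ : ω₀ ^ 2 = -((D : ℕ) : 𝓞 (sqrtNegField K D)) := by
    apply RingOfIntegers.ext
    simp only [map_pow, map_neg, map_natCast, hω₀def, RingOfIntegers.map_mk, hω]
  have hD0 : D ≠ 0 := by
    rintro rfl
    exact (Fact.out : ¬ IsSquare (-((0 : ℕ) : K))) ⟨0, by simp⟩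
  have hω₀0 : ω₀ ≠ 0 := by
    intro h
    have : ((D : ℕ) : 𝓞 (sqrtNegField K D)) = 0 := by
      have h2 := hω₀
      rw [h, zero_pow two_ne_zero] at h2
      exact (neg_eq_zero.mp h2.symm)
    exact hD0 (by exact_mod_cast this)
  -- a prime `w` of `𝓞 L` over `v`, unramified by hypothesis
  haveI := v.isMaximal
  obtain ⟨W, hWmax, hWover⟩ :=
    Ideal.exists_maximal_ideal_liesOver_of_isIntegral (S := 𝓞 (sqrtNegField K D)) v.asIdeal
  haveI := hWover
  let w : HeightOneSpectrum (𝓞 (sqrtNegField K D)) :=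
    ⟨W, hWmax.isPrime, Ideal.ne_bot_of_liesOver_of_ne_bot v.ne_bot W⟩
  haveI : w.asIdeal.LiesOver v.asIdeal := hWover
  have he : w.asIdeal.ramificationIdx (𝓞 K) = 1 := hunr.ramificationIdx_eq_one hWover
  -- `w(D) = v(D) = exp(-1)`
  have h := HeightOneSpectrum.intValuation_liesOver (A := 𝓞 K) (B := 𝓞 (sqrtNegField K D)) v w
    ((D : ℕ) : 𝓞 K)
  rw [Ideal.ramificationIdx'_eq_ramificationIdx v.asIdeal w.asIdeal v.ne_bot, he, pow_one, hval,
    map_natCast] at h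
  -- but `w(D) = w(ω)²`
  have hsq : w.intValuation ((D : ℕ) : 𝓞 (sqrtNegField K D)) = w.intValuation ω₀ ^ 2 := by
    rw [show ((D : ℕ) : 𝓞 (sqrtNegField K D)) = -(ω₀ ^ 2) by rw [hω₀, neg_neg], Valuation.map_neg,
      map_pow]
  rw [hsq, HeightOneSpectrum.intValuation_eq_exp_neg_multiplicity w hω₀0, ← WithZero.exp_nsmul,
    Int.nsmul_eq_mul,
    WithZero.exp_inj] at h
  omega

end Ramified

/-! ### §3. The imaginary quadratic subfield `ℚ(√-D)`, split at every `q` with `8q ∣ D + 1` -/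

section Subfield

variable {K : Type*} [Field K] [NumberField K] {D : ℕ} [Fact (¬ IsSquare (-(D : K)))]

/-- **The subfield `F₀ = ℚ(√-D)` of `K(√-D)` is imaginary quadratic, and every rational prime `q`
with `-D ≡ 1 (mod 8q)` splits in it** (`-D` is then a non-zero square in `ℚ_q`, also for `q = 2`:
`isSquare_adicCompletion_neg_natCast` over `ℚ`; two places by
`QuadraticExtension.ncard_finitePlacesOver_eq_two_of_isSquare`).  Same construction as
`hasSplitImaginaryQuadraticSubfield_sqrtNegField`, with `F₀` exposed so that one subfield serves
several primes. [cite: HarrisLanTaylorThorneRMS2016, §1 (p. 11): "`p` which splits in `F₀`"] -/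
theorem exists_intermediateField_hasTwoPrimesOver (hD0 : D ≠ 0) :
    ∃ F₀ : IntermediateField ℚ (sqrtNegField K D),
      (Module.finrank ℚ F₀ = 2 ∧ IsTotallyComplex F₀) ∧
        ∀ p : ℕ, p.Prime → 8 * p ∣ D + 1 → HasTwoPrimesOver F₀ p := by
  classical
  set ω : sqrtNegField K D := QuadraticAlgebra.omega with hωdef
  have hω : ω ^ 2 = -(D : sqrtNegField K D) := by rw [hωdef, omega_sq, map_neg, map_natCast]
  have hωim : ω.im = 1 := rfl
  -- `F₀ = ℚ(ω)`
  set F₀ : IntermediateField ℚ (sqrtNegField K D) := ℚ⟮ω⟯ with hF₀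
  set ω₀ : F₀ := ⟨ω, IntermediateField.mem_adjoin_simple_self ℚ ω⟩ with hω₀def
  have hω₀ : ω₀ ^ 2 = algebraMap ℚ F₀ (-(D : ℚ)) := by
    apply Subtype.ext
    simp [hω₀def, hω]
  have hω₀' : ω₀ ^ 2 = -(D : F₀) := by rw [hω₀, map_neg, map_natCast]
  have hω₀Q : ∀ r : ℚ, algebraMap ℚ F₀ r ≠ ω₀ := by
    intro r h
    have h' : ((algebraMap ℚ F₀ r : F₀) : sqrtNegField K D).im = ω.im := by rw [h]
    have h0 : ((algebraMap ℚ F₀ r : F₀) : sqrtNegField K D) = (r : sqrtNegField K D) :=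
      eq_ratCast ((F₀.val : F₀ →+* sqrtNegField K D).comp (algebraMap ℚ F₀)) r
    rw [h0, hωim] at h'
    exact zero_ne_one h'
  -- `[F₀ : ℚ] = 2`
  have hint : IsIntegral ℚ ω := by
    refine ⟨X ^ 2 + C (D : ℚ), monic_X_pow_add_C _ two_ne_zero, ?_⟩
    rw [← aeval_def]
    simp [hω]
  have hdeg : (minpoly ℚ ω).natDegree = 2 := by
    apply le_antisymm
    · have h := minpoly.degree_le_of_ne_zero ℚ ω (p := X ^ 2 + C (D : ℚ))
        (monic_X_pow_add_C _ two_ne_zero).ne_zero (by simp [hω])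
      rw [degree_X_pow_add_C two_pos] at h
      exact natDegree_le_iff_degree_le.mpr h
    · rw [minpoly.two_le_natDegree_iff hint]
      rintro ⟨r, hr⟩
      have h' : ((r : sqrtNegField K D)).im = ω.im := by
        rw [← eq_ratCast (algebraMap ℚ (sqrtNegField K D)) r, hr]
      rw [hωim] at h'
      exact zero_ne_one h'
  have hfin : Module.finrank ℚ F₀ = 2 := by rw [hF₀, IntermediateField.adjoin.finrank hint, hdeg]
  haveI : Algebra.IsQuadraticExtension ℚ F₀ := ⟨hfin⟩
  -- `F₀` is totally complex
  have htc : IsTotallyComplex F₀ := isTotallyComplex_of_sq_eq_neg hD0 hω₀'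
  refine ⟨F₀, ⟨hfin, htc⟩, fun p hp hpD ↦ ?_⟩
  -- two places of `F₀` above `p`
  obtain ⟨v, hv⟩ := exists_heightOneSpectrum_natCast_mem ℚ hp
  have hsq := isSquare_adicCompletion_neg_natCast (K := ℚ) v hp hv hpD
  have h2 : (QuadraticForms.finitePlacesOver F₀ v).ncard = 2 :=
    QuadraticForms.QuadraticExtension.ncard_finitePlacesOver_eq_two_of_isSquare (K := ℚ) (E := F₀)
      hω₀ hω₀Q v hsq
  obtain ⟨w, w', hne, hww'⟩ := Set.ncard_eq_two.mp h2
  have hmem : ∀ u ∈ QuadraticForms.finitePlacesOver F₀ v, ((p : ℕ) : 𝓞 F₀) ∈ u.asIdeal := by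
    intro u hu
    rw [QuadraticForms.mem_finitePlacesOver_iff] at hu
    have h : ((p : ℕ) : 𝓞 ℚ) ∈ (u.under (𝓞 ℚ)).asIdeal := by rw [hu]; exact hv
    rw [HeightOneSpectrum.under_asIdeal, Ideal.under_def, Ideal.mem_comap, map_natCast] at h
    exact h
  exact ⟨w, w', hne, hmem w (by rw [hww']; exact Set.mem_insert _ _),
    hmem w' (by rw [hww']; exact Set.mem_insert_of_mem _ (Set.mem_singleton _))⟩

end Subfield

end PatchingFamily

/-! ### §4. The representation attached to a member of the family -/

namespace HarrisLanTaylorThorne2016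

variable {n : ℕ} {K : Type} [Field K] [NumberField K] {hcpt : isCompact_glFiniteIntegralLevel n K}
  {ℓ : ℕ} [Fact ℓ.Prime]

omit [NumberField K] in
/-- A rational integer lies in a prime of `𝓞 M` iff it lies in the prime of `𝓞 K` below.
[folklore] -/
theorem natCast_mem_iff_natCast_mem_under {M : Type*} [Field M] [Algebra K M]
    (w : HeightOneSpectrum (𝓞 M)) (q : ℕ) :
    ((q : ℕ) : 𝓞 M) ∈ w.asIdeal ↔ ((q : ℕ) : 𝓞 K) ∈ (w.under (𝓞 K)).asIdeal := by
  rw [HeightOneSpectrum.under_asIdeal, Ideal.under_def, Ideal.mem_comap, map_natCast]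

/-- **A strong base change between cuspidal data is a weak one, hence regular algebraic when `π`
is** (granted the archimedean clause `ArthurClozel1989_strongLifting_archimedean` of
Arthur–Clozel's Thm. 5.1): the Satake relation at every place over an unramified `v` holds in
particular almost everywhere (only finitely many places of `F` ramify in `E`,
`GaloisRepresentations.finite_setOf_not_isUnramifiedIn`; `eventually_under`), so the infinity
type of `P` is `τ ↦ T(τ|_F)` (`hasInfinityType_baseChange`) and regularity / `C`-algebraicity of
the exponents carry over.  (Same content as `IsUnramifiedBaseChangeLift.isRegularAlgebraic` of the
sibling `BaseChangeUnramifiedLift`, proposed alongside; stated on the unfolded relation so that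
this proofs file is self-contained.) [cite: ArthurClozelAMS120, Ch. 3 Thm. 5.1 and Ch. 1 §7] -/
theorem isRegularAlgebraic_of_strongBaseChange {F E : Type} [Field F] [NumberField F] [Field E]
    [NumberField E] [Algebra F E] [IsGalois F E] {hF : isCompact_glFiniteIntegralLevel n F}
    {hE : isCompact_glFiniteIntegralLevel n E} (harch : ArthurClozel1989_strongLifting_archimedean)
    (hl : (Module.finrank F E).Prime) {π : CuspidalAutomorphicRepData n F hF}
    {P : CuspidalAutomorphicRepData n E hE}
    (h : ∀ (w : HeightOneSpectrum (𝓞 E)) (v : HeightOneSpectrum (𝓞 F)) (α : Multiset ℂ),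
      w.asIdeal.under (𝓞 F) = v.asIdeal → Algebra.IsUnramifiedIn (𝓞 E) v.asIdeal →
        π.1.HasSatakeParamAt v α → P.1.HasSatakeParamAt w (α.map (· ^ w.asIdeal.inertiaDeg (𝓞 F))))
    (hπ : π.1.IsRegularAlgebraic) : P.1.IsRegularAlgebraic := by
  haveI : IsCyclic (E ≃ₐ[F] E) :=
    isCyclic_of_prime_card (p := Module.finrank F E) (hp := ⟨hl⟩) (IsGalois.card_aut_eq_finrank F E)
  -- strong ⇒ weak
  have hfin : ∀ᶠ v : HeightOneSpectrum (𝓞 F) in cofinite,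
      Algebra.IsUnramifiedIn (𝓞 E) v.asIdeal := by
    filter_upwards [(GaloisRepresentations.finite_setOf_not_isUnramifiedIn F E).compl_mem_cofinite]
      with v hv
    simpa using hv
  have hweak : IsWeakBaseChangeLiftAE π.1 P.1 := by
    filter_upwards [eventually_under (E := E) hfin] with w hw v α hwv hα
    exact h w v α hwv (hw v hwv) hα
  obtain ⟨T, hT, hTra⟩ := hπ
  exact ⟨T.baseChange E, harch.hasInfinityType_baseChange ‹_› hl hweak hT, hTra.1.baseChange,
    hTra.2.baseChange⟩

/-- **The representation of a member** (Harris–Lan–Taylor–Thorne, proof of Cor. 7.14, following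
Harris–Taylor pp. 229–231: "`Res^L_{F_A}(Π)` continues to satisfy the conditions of the theorem,
but for `F_A` … there is a continuous representation `R_l(Res^L_{F_A}(Π))`").  Let `K` be totally
real or CM, `π` cuspidal regular algebraic on `GL_n(𝔸_K)`, `n ≥ 2`, `E` a Frobenius datum of `π`
(`∏_{a ∈ E v}(X - a) = arithFrobPolyOfSatake ı q_v n α_v`), and `B` a set of rational primes
containing every prime below a place of `K` ramified over `ℤ` or a ramified place of `π`.  For a
member `D ∈ GoodPrime K (8ℓ) B`: the place `v₀ ∣ D` of `K` is unramified over `ℤ` and ramified in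
`K_D = K(√-D)` (§2) and `π` is unramified there, so the strong base change `π_D` of `π` to `K_D`
(hypothesis `hBC`: Arthur–Clozel Thm. 4.2 (a) + Thm. 5.1, with Chenevier–Harris's cuspidality
criterion) is cuspidal, and regular algebraic (`harch`); `K_D` is CM (`GoodPrime.isCMField`) and
contains `ℚ(√-D)` in which `ℓ` splits (`8ℓ ∣ D + 1`, §3); Thm. 7.13 (`theorem713_of_leaves` from
`h627`) gives `ρ = r_{ℓ,ı}(π_D)`, semisimple.  Then: **(i)** `ρ` is compatible almost everywhere
with `E` (`CompatibleAE`): at the cofinitely many places `w` of `K_D` over a rational prime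
`q ≠ ℓ` unramified in `K_D` above which `π_D` is unramified (`finite_setOf_not_exists_goodPrime`)
and over a place `v` of `K` unramified in `K_D` at which `π` is unramified, Thm. 7.13 (second
alternative) and the strong relation `t_{π_D,w} = t_{π,v}^{f}` give the characteristic polynomial
`arithFrobPolyOfSatake ı q_v^f n (α_v^f) = ∏_{a ∈ E v}(X - a^f)` (`arithFrobPolyOfSatake_pow`);
**(ii)** for a rational prime `q ≠ ℓ` above which `π` is unramified with `8q ∣ D + 1`, at every
place `w` over every `v ∣ q`: `q` splits in `ℚ(√-D)` (first alternative of Thm. 7.13), every place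
of `K` over `q` splits completely in `K_D` (`ncard_primesOver_sqrtNegField_eq_two`; so `π_D` is
unramified above `q` with `t_{π_D,w} = t_{π,v}`, `f(w|v) = 1`, `q_w = q_v`), whence `ρ` is
unramified at `w` with characteristic polynomial `arithFrobPolyOfSatake ı q_v n α_v`.
[cite: HarrisLanTaylorThorneRMS2016, Thm. 7.13 and proof of Cor. 7.14 (p. 232)]
[cite: HarrisTaylorAMS2001, proof of Thm. VII.1.9 (pp. 229–231)] -/
theorem exists_rep_member (h627 : corollary627_splitOrUnramified)
    (harch : ArthurClozel1989_strongLifting_archimedean)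
    (hBC : ∀ (n : ℕ) (F E : Type) [Field F] [NumberField F] [Field E] [NumberField E] [Algebra F E]
      [IsGalois F E], (Module.finrank F E).Prime →
      ∀ (hF : isCompact_glFiniteIntegralLevel n F) (π : CuspidalAutomorphicRepData n F hF),
        (∃ v : HeightOneSpectrum (𝓞 F),
            ¬ Algebra.IsUnramifiedIn (𝓞 E) v.asIdeal ∧ π.1.IsUnramifiedAt v) →
        ∀ (hE : isCompact_glFiniteIntegralLevel n E),
          ∃ P : CuspidalAutomorphicRepData n E hE,
            ∀ (w : HeightOneSpectrum (𝓞 E)) (v : HeightOneSpectrum (𝓞 F)) (α : Multiset ℂ),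
              w.asIdeal.under (𝓞 F) = v.asIdeal → Algebra.IsUnramifiedIn (𝓞 E) v.asIdeal →
                π.1.HasSatakeParamAt v α →
                  P.1.HasSatakeParamAt w (α.map (· ^ w.asIdeal.inertiaDeg (𝓞 F))))
    (hn : 1 < n) (hK : IsTotallyReal K ∨ IsCMField K) (π : CuspidalAutomorphicRepData n K hcpt)
    (hπ : π.1.IsRegularAlgebraic) (ι : PadicAlgCl ℓ ≃+* ℂ)
    (E : HeightOneSpectrum (𝓞 K) → Multiset (PadicAlgCl ℓ))
    (hE : ∀ (v : HeightOneSpectrum (𝓞 K)) (α : Multiset ℂ), π.1.HasSatakeParamAt v α →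
      ((E v).map fun a ↦ X - C a).prod = arithFrobPolyOfSatake ι v.residueCard n α)
    {B : Set ℕ}
    (hB : ∀ D : ℕ, D.Prime → D ∉ B → ∀ v : HeightOneSpectrum (𝓞 K), ((D : ℕ) : 𝓞 K) ∈ v.asIdeal →
      Algebra.IsUnramifiedAt ℤ v.asIdeal ∧ π.1.IsUnramifiedAt v)
    (i : GoodPrime K (8 * ℓ) B) :
    ∃ ρ : FramedGaloisRep (sqrtNegField K i.1) (PadicAlgCl ℓ) n, ρ.toGaloisRep.IsSemisimple ∧
      CompatibleAE E ρ ∧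
      ∀ q : ℕ, q.Prime → q ≠ ℓ → π.1.IsUnramifiedAbove q → 8 * q ∣ i.1 + 1 →
        ∀ v : HeightOneSpectrum (𝓞 K), ((q : ℕ) : 𝓞 K) ∈ v.asIdeal →
          ∀ w : HeightOneSpectrum (𝓞 (sqrtNegField K i.1)), w.asIdeal.under (𝓞 K) = v.asIdeal →
            ∀ α : Multiset ℂ, π.1.HasSatakeParamAt v α →
              ρ.IsUnramifiedAt w ∧
                ρ.HasFrobCharpolyAt w (arithFrobPolyOfSatake ι v.residueCard n α) := by
  classical
  have hℓ : ℓ.Prime := Fact.out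
  have hD : i.1.Prime := i.2.1
  have hD0 : i.1 ≠ 0 := i.ne_zero
  have hDℓ : 8 * ℓ ∣ i.1 + 1 := i.2.2.1
  -- the member field `L = K(√-D)` and its level structure
  have hL : isCompact_glFiniteIntegralLevel n (sqrtNegField K i.1) :=
    isCompact_glFiniteIntegralLevel_holds n (sqrtNegField K i.1)
  have hl2 : (Module.finrank K (sqrtNegField K i.1)).Prime := by
    rw [finrank_sqrtNegField]; exact Nat.prime_two
  -- a ramified place above `D` at which `π` is unramified
  obtain ⟨v₀, hv₀⟩ := exists_heightOneSpectrum_natCast_mem K hD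
  obtain ⟨hunrZ, hπv₀⟩ := hB i.1 hD i.2.2.2.1 v₀ hv₀
  have hram : ¬ Algebra.IsUnramifiedIn (𝓞 (sqrtNegField K i.1)) v₀.asIdeal :=
    not_isUnramifiedIn_sqrtNegField v₀ (intValuation_natCast_eq_of_isUnramifiedAt hD v₀ hv₀ hunrZ)
  -- the strong base change `Π = π_D`, cuspidal and regular algebraic
  obtain ⟨P, hP⟩ := hBC n K (sqrtNegField K i.1) hl2 hcpt π ⟨v₀, hram, hπv₀⟩ hL
  have hPra : P.1.IsRegularAlgebraic := isRegularAlgebraic_of_strongBaseChange harch hl2 hP hπ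
  -- `L` is CM and contains `ℚ(√-D)`, in which `ℓ` and every `q` with `8q ∣ D+1` split
  have hCM : IsCMField (sqrtNegField K i.1) := i.isCMField hK
  obtain ⟨F₀, hF₀, hF₀split⟩ :=
    exists_intermediateField_hasTwoPrimesOver (K := K) (D := i.1) hD0
  -- Thm. 7.13 for `Π`
  obtain ⟨ρ, hρss, h713⟩ := theorem713_of_leaves
    Literature.NumberTheory.GaloisRepresentations.HarrisLanTaylorThorne2016.prop712Hausdorff_holds h627
    chebotarev_artinRep_holds
    hL ℓ hn hCM F₀ hF₀ (hF₀split ℓ hℓ hDℓ) P hPra ι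
  refine ⟨ρ, hρss, ?_, ?_⟩
  · -- (i) compatibility almost everywhere with the datum of `π`
    have hgood := (finite_setOf_not_exists_goodPrime P.1 P.1.hasSatakeParamAt_cofinite_holds ℓ
      hℓ).compl_mem_cofinite
    have hunrK : ∀ᶠ v : HeightOneSpectrum (𝓞 K) in cofinite,
        Algebra.IsUnramifiedIn (𝓞 (sqrtNegField K i.1)) v.asIdeal := by
      filter_upwards [(GaloisRepresentations.finite_setOf_not_isUnramifiedIn K
        (sqrtNegField K i.1)).compl_mem_cofinite] with v hv
      simpa using hv
    have hπunr : ∀ᶠ v : HeightOneSpectrum (𝓞 K) in cofinite, π.1.IsUnramifiedAt v :=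
      π.1.hasSatakeParamAt_cofinite_holds
    show ∀ᶠ w : HeightOneSpectrum (𝓞 (sqrtNegField K i.1)) in cofinite, _
    filter_upwards [hgood, eventually_under (E := sqrtNegField K i.1) hunrK,
      eventually_under (E := sqrtNegField K i.1) hπunr] with w hw hwunr hwπ
    simp only [Set.mem_compl_iff, Set.mem_setOf_eq, not_not] at hw
    obtain ⟨q, hq, hqℓ, hqunr, hPq, hqw⟩ := hw
    obtain ⟨α, hα⟩ := hwπ (w.under (𝓞 K)) rfl
    have hβ := hP w (w.under (𝓞 K)) α rfl (hwunr _ rfl) hα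
    obtain ⟨hunr_w, hch⟩ := h713 q hq hqℓ (Or.inr hqunr) hPq w hqw _ hβ
    refine ⟨hunr_w, ?_⟩
    rw [GaloisRepresentations.residueCard_eq_residueCard_pow_inertiaDeg (v := w.under (𝓞 K)) (w := w)
      rfl, arithFrobPolyOfSatake_pow] at hch
    have hroots : E (w.under (𝓞 K)) =
        (arithFrobPolyOfSatake ι (w.under (𝓞 K)).residueCard n α).roots := by
      rw [← hE _ α hα, Polynomial.roots_multiset_prod_X_sub_C]
    rw [frobPoly_eq_prod_map_pow, hroots]
    exact hch
  · -- (ii) at the places over a good `q` with `8q ∣ D + 1`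
    intro q hq hqℓ hπq hqD v hqv w hwv α hα
    -- `Π` is unramified above `q`: every place of `K` over `q` splits completely in `L`
    have hPq : P.1.IsUnramifiedAbove q := by
      intro w' hqw'
      have hqv' : ((q : ℕ) : 𝓞 K) ∈ (w'.under (𝓞 K)).asIdeal :=
        (natCast_mem_iff_natCast_mem_under (K := K) w' q).mp hqw'
      obtain ⟨α', hα'⟩ := hπq _ hqv'
      have hunr' : Algebra.IsUnramifiedIn (𝓞 (sqrtNegField K i.1)) (w'.under (𝓞 K)).asIdeal :=
        isUnramifiedIn_of_ncard_eq_finrank _ (by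
          rw [finrank_sqrtNegField]
          exact ncard_primesOver_sqrtNegField_eq_two _ hq hqv' hqD)
      exact ⟨_, hP w' _ α' rfl hunr' hα'⟩
    have hsplit : (v.asIdeal.primesOver (𝓞 (sqrtNegField K i.1))).ncard =
        Module.finrank K (sqrtNegField K i.1) := by
      rw [finrank_sqrtNegField]
      exact ncard_primesOver_sqrtNegField_eq_two v hq hqv hqD
    have hunr : Algebra.IsUnramifiedIn (𝓞 (sqrtNegField K i.1)) v.asIdeal :=
      isUnramifiedIn_of_ncard_eq_finrank v hsplit
    have hf : w.asIdeal.inertiaDeg (𝓞 K) = 1 := inertiaDeg_eq_one_of_ncard_eq_finrank v hsplit w hwv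
    have hβ : P.1.HasSatakeParamAt w α := by
      have h := hP w v α hwv hunr hα
      rw [hf] at h
      simpa using h
    have hqw : ((q : ℕ) : 𝓞 (sqrtNegField K i.1)) ∈ w.asIdeal := by
      rw [natCast_mem_iff_natCast_mem_under (K := K) w q]
      change ((q : ℕ) : 𝓞 K) ∈ w.asIdeal.under (𝓞 K)
      rw [hwv]
      exact hqv
    obtain ⟨hunr_w, hch⟩ := h713 q hq hqℓ (Or.inl (hF₀split q hq hqD)) hPq w hqw α hβ
    refine ⟨hunr_w, ?_⟩
    rwa [GaloisRepresentations.residueCard_eq_residueCard_pow_inertiaDeg hwv, hf, pow_one] at hch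

/-! ### §5. Thm. A (existence, `n ≥ 2`) from the three automorphic leaves -/

/-- **Harris–Lan–Taylor–Thorne 2016, Theorem A — existence, for `n ≥ 2`, from its automorphic
leaves.**  Let `K` be totally real or CM and `π` a regular algebraic cuspidal automorphic
representation of `GL_n(𝔸_K)`, `n ≥ 2`; let `ℓ` be a prime and `ı : ℚ̄_ℓ ≅ ℂ`.  Granted
(1) HLTT Cor. 6.27 (`corollary627_splitOrUnramified`, named fact), (2) Arthur–Clozel's strong
cuspidal base change in prime degree for extensions ramified at a place where `π` is unramified
(Ch. 3, Thm. 4.2 (a) with Thm. 5.1 and (1.1); hypothesis `hBC`, the unramified Satake relation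
`t_{Π,w} = t_{π,v}^{f(w|v)}` at every place over an unramified `v`, for a cuspidal `Π`), and (3) the archimedean clause of strong lifting
(`ArthurClozel1989_strongLifting_archimedean`, named fact), there is a continuous semisimple
`r : Γ_K → GL_n(ℚ̄_ℓ)` with the characterising property of `r_{ℓ,ı}(π)`: for every rational prime
`q ≠ ℓ` above which `π` is unramified and every `v ∣ q`, `r` is unramified at `v` with
`char(r(Frob_v)) = arithFrobPolyOfSatake ı q_v n α_v` (`IsCompatible π ı r`).  Proof = the printed
one (Cor. 7.14 from Thm. 7.13 "by using lemma 1 of [54]", "the same argument used in the proof of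
theorem VII.1.9 of [29]"): the representations of the members of the `∅`-general family `K(√-D)`,
`D ∈ GoodPrime K (8ℓ) B` (`exists_rep_member`, with `B` the finitely many primes below a place
ramified over `ℤ` or a ramified place of `π`), patched by Sorensen's lemma and read off at the
places over the good `q` through a member with `8q ∣ D + 1` in which `v` splits completely
(`exists_isCompatible_of_members'`, `GoodPrime.exists_dvd_split`).  The cases `n ≤ 1` of
`theoremA_existence` are not covered (as in `theorem713_of_leaves`; `n = 1` is Weil's theorem on
algebraic Hecke characters). [cite: HarrisLanTaylorThorneRMS2016, Thm. A (p. 3) and Cor. 7.14 (p. 232)]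
[cite: HarrisTaylorAMS2001, proof of Thm. VII.1.9 (pp. 229–232)] -/
theorem theoremA_existence_of_baseChange (h627 : corollary627_splitOrUnramified)
    (harch : ArthurClozel1989_strongLifting_archimedean)
    (hBC : ∀ (n : ℕ) (F E : Type) [Field F] [NumberField F] [Field E] [NumberField E] [Algebra F E]
      [IsGalois F E], (Module.finrank F E).Prime →
      ∀ (hF : isCompact_glFiniteIntegralLevel n F) (π : CuspidalAutomorphicRepData n F hF),
        (∃ v : HeightOneSpectrum (𝓞 F),
            ¬ Algebra.IsUnramifiedIn (𝓞 E) v.asIdeal ∧ π.1.IsUnramifiedAt v) →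
        ∀ (hE : isCompact_glFiniteIntegralLevel n E),
          ∃ P : CuspidalAutomorphicRepData n E hE,
            ∀ (w : HeightOneSpectrum (𝓞 E)) (v : HeightOneSpectrum (𝓞 F)) (α : Multiset ℂ),
              w.asIdeal.under (𝓞 F) = v.asIdeal → Algebra.IsUnramifiedIn (𝓞 E) v.asIdeal →
                π.1.HasSatakeParamAt v α →
                  P.1.HasSatakeParamAt w (α.map (· ^ w.asIdeal.inertiaDeg (𝓞 F))))
    (hcpt : isCompact_glFiniteIntegralLevel n K) (hn : 1 < n) (hK : IsTotallyReal K ∨ IsCMField K)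
    (π : CuspidalAutomorphicRepData n K hcpt) (hπ : π.1.IsRegularAlgebraic)
    (ι : PadicAlgCl ℓ ≃+* ℂ) :
    ∃ r : FramedGaloisRep K (PadicAlgCl ℓ) n, r.toGaloisRep.IsSemisimple ∧ IsCompatible π.1 ι r := by
  classical
  have hℓ : ℓ.Prime := Fact.out
  -- the finite set `B` of bad rational primes
  choose f hf using fun w : HeightOneSpectrum (𝓞 K) ↦ exists_natPrime_natCast_mem w
  have hR : {w : HeightOneSpectrum (𝓞 K) | ¬ Algebra.IsUnramifiedAt ℤ w.asIdeal}.Finite := by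
    refine (Ideal.finite_factors (differentIdeal_ne_bot (A := ℤ) (B := 𝓞 K))).subset
      fun w hw ↦ ?_
    simp only [Set.mem_setOf_eq] at hw ⊢
    by_contra hdvd
    exact hw ((not_dvd_differentIdeal_iff (A := ℤ)).mp hdvd)
  have hcof : {w : HeightOneSpectrum (𝓞 K) | ¬ π.1.IsUnramifiedAt w}.Finite :=
    π.1.hasSatakeParamAt_cofinite_holds
  set B : Set ℕ := f '' ({w | ¬ Algebra.IsUnramifiedAt ℤ w.asIdeal} ∪ {w | ¬ π.1.IsUnramifiedAt w})
    with hBdef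
  have hBfin : B.Finite := (hR.union hcof).image f
  have hB : ∀ D : ℕ, D.Prime → D ∉ B → ∀ v : HeightOneSpectrum (𝓞 K),
      ((D : ℕ) : 𝓞 K) ∈ v.asIdeal → Algebra.IsUnramifiedAt ℤ v.asIdeal ∧ π.1.IsUnramifiedAt v := by
    intro D hD hDB v hv
    have hfv : f v = D := natPrime_eq_of_natCast_mem (hf v).1 hD (hf v).2 hv
    by_contra h
    rw [not_and_or] at h
    exact hDB ⟨v, by simpa [Set.mem_union, Set.mem_setOf_eq] using h, hfv⟩
  have hm : 8 * ℓ ≠ 0 := mul_ne_zero (by norm_num) hℓ.ne_zero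
  refine exists_isCompatible_of_members' π.1 ι hm hBfin fun E hE ↦ ?_
  choose ρ hρss hρc hρT using fun i : GoodPrime K (8 * ℓ) B ↦
    exists_rep_member h627 harch hBC hn hK π hπ ι E hE hB i
  refine ⟨ρ, hρss, hρc, fun q hq hqℓ hπq v hqv ↦ ?_⟩
  obtain ⟨i, hqi, hsplit⟩ := GoodPrime.exists_dvd_split K (8 * ℓ) B hm hBfin v (8 * q)
    (mul_ne_zero (by norm_num) hq.ne_zero)
  refine ⟨i, ?_, fun w hwv α hα ↦ hρT i q hq hqℓ hπq hqi v hqv w hwv α hα⟩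
  rw [finrank_sqrtNegField] at hsplit
  exact hsplit

/-! ### §6. The degenerate rank `0`, and Thm. A from its leaves including the case `n = 1` -/

/-- **The case `n = 0` of Thm. A** (degenerate; recorded so that the eventual discharge of
`theoremA_existence`, which quantifies over all `n`, reduces to `n = 1` and `n ≥ 2`): the trivial
homomorphism `Γ_K → GL_0(ℚ̄_ℓ)` is semisimple (its space `ℚ̄_ℓ⁰` has one subrepresentation) and
compatible with any `π` on `GL_0(𝔸_K)` (a Satake parameter has `0` entries, so the predicted
polynomial is the empty product `1 = det(X - ·)` on `0 × 0` matrices, and every inertia group maps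
to `1`). [folklore] -/
theorem theoremA_existence_rank_zero {K : Type} [Field K] [NumberField K]
    (hcpt : isCompact_glFiniteIntegralLevel 0 K) (π : CuspidalAutomorphicRepData 0 K hcpt)
    (ι : PadicAlgCl ℓ ≃+* ℂ) :
    ∃ r : FramedGaloisRep K (PadicAlgCl ℓ) 0, r.toGaloisRep.IsSemisimple ∧ IsCompatible π.1 ι r := by
  refine ⟨1, ?_, ?_⟩
  · haveI : Subsingleton (Subrepresentation
        ((1 : FramedGaloisRep K (PadicAlgCl ℓ) 0).toGaloisRep.toRepresentation)) :=
      ⟨fun a b ↦ Subrepresentation.toSubmodule_injective (Subsingleton.elim _ _)⟩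
    exact Subsingleton.instComplementedLattice
  · intro q hq hqℓ hπq v hv α hα
    have hα0 : α = 0 := Multiset.card_eq_zero.mp hα.card_eq
    subst hα0
    refine ⟨fun 𝔓 _ σ _ ↦ by simp, fun 𝔓 _ σ _ ↦ ?_⟩
    simp [FramedRep.charpoly, arithFrobPolyOfSatake, Matrix.charpoly, Matrix.det_isEmpty]

/-- **Thm. A (existence) from its leaves.**  `theoremA_existence` — for *every* `n` — follows from
the three automorphic leaves of `theoremA_existence_of_baseChange` (HLTT Cor. 6.27; Arthur–Clozel's
strong cuspidal base change `hBC`; the archimedean clause) together with **its own case `n = 1`**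
(hypothesis `h₁`, stated as the `n = 1` instance of `theoremA_existence`): "We may suppose that
`n > 1`, as in the case `n = 1` the result is well known" (HLTT p. 232, proof of Thm. 7.13) — it
is Weil's theorem that a regular algebraic cuspidal automorphic representation of `GL_1(𝔸_K)`,
i.e. an algebraic Hecke character,
has an `ℓ`-adic avatar with the predicted Frobenius values at its unramified places (A. Weil, *On a
certain type of characters of the idèle-class group of an algebraic number-field*, 1956; the
finite-order case is the tree's `HeckeCharacter.exists_lAdic_of_isFiniteOrder`), which is not yet
in the tree in the datum model and is therefore an explicit hypothesis here, not a proof.  The case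
`n = 0` is `theoremA_existence_rank_zero`.  This theorem records exactly what a discharge
`theoremA_existence_holds` still requires.
[cite: HarrisLanTaylorThorneRMS2016, Thm. A (p. 3), Cor. 7.14 and proof of Thm. 7.13 (p. 232)] -/
theorem theoremA_existence_of_leaves (h627 : corollary627_splitOrUnramified)
    (harch : ArthurClozel1989_strongLifting_archimedean)
    (hBC : ∀ (n : ℕ) (F E : Type) [Field F] [NumberField F] [Field E] [NumberField E] [Algebra F E]
      [IsGalois F E], (Module.finrank F E).Prime →
      ∀ (hF : isCompact_glFiniteIntegralLevel n F) (π : CuspidalAutomorphicRepData n F hF),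
        (∃ v : HeightOneSpectrum (𝓞 F),
            ¬ Algebra.IsUnramifiedIn (𝓞 E) v.asIdeal ∧ π.1.IsUnramifiedAt v) →
        ∀ (hE : isCompact_glFiniteIntegralLevel n E),
          ∃ P : CuspidalAutomorphicRepData n E hE,
            ∀ (w : HeightOneSpectrum (𝓞 E)) (v : HeightOneSpectrum (𝓞 F)) (α : Multiset ℂ),
              w.asIdeal.under (𝓞 F) = v.asIdeal → Algebra.IsUnramifiedIn (𝓞 E) v.asIdeal →
                π.1.HasSatakeParamAt v α →
                  P.1.HasSatakeParamAt w (α.map (· ^ w.asIdeal.inertiaDeg (𝓞 F))))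
    (h₁ : ∀ {K : Type} [Field K] [NumberField K] (hcpt : isCompact_glFiniteIntegralLevel 1 K),
      IsTotallyReal K ∨ IsCMField K →
      ∀ (π : CuspidalAutomorphicRepData 1 K hcpt), π.1.IsRegularAlgebraic → ∀ (ℓ : ℕ) [Fact ℓ.Prime]
        (ι : PadicAlgCl ℓ ≃+* ℂ),
        ∃ r : FramedGaloisRep K (PadicAlgCl ℓ) 1, r.toGaloisRep.IsSemisimple ∧ IsCompatible π.1 ι r) :
    theoremA_existence := by
  intro n K _ _ hcpt hK π hπ ℓ _ ι
  rcases Nat.lt_trichotomy n 1 with hn | rfl | hn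
  · obtain rfl : n = 0 := Nat.lt_one_iff.mp hn
    exact theoremA_existence_rank_zero hcpt π ι
  · exact h₁ hcpt hK π hπ ℓ ι
  · exact theoremA_existence_of_baseChange h627 harch hBC hcpt hn hK π hπ ι

end HarrisLanTaylorThorne2016

end Literature.NumberTheory.Automorphic

end
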